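import Summits.CriticalPhenomena.PercolationContinuityZ3.Theorems.Transplant.SkelPhiRootKits
import HarnessLib

/-!
# D″ node, (R) layer — SCHEDULE-GENERIC form, part 1 (lane INBOX 2026-08-21 ≈08:05Z: the root band schedule of record may change —
# `Band.scheduleR` → `Band.scheduleRO` (no idle `hρ0`) or an appended short-prefix schedule — so the (R) plumbing is restated ONCE for ANY
# planar schedule `Sc : ChainPlanar.Schedule` whose regions lie in the narrow between-box `BtwN 0 du ∪ Q (0 + du)` and miss the root cube `Q 0`):
# the regions read through `Skelφ.planarWindowWin hlip w₀ Rt` inside the cut root world `Skelφ.rootUS`, off the wired root cube, the root law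
# `W0sub rootUS` a subbox weighting of the window graph on them, every core inside the root region, and the RIM EXCESS of the chain data
# `Skelφ.rootWCD … Sc …` — the schedule-generic successors of file 5's `rootSched_*` facts (`SkelPhiRootKits`, instance `RootRun2.rootSched`)

builds on p205010 (kernel theorem, internal audit signed; external expert review pending) — nothing in this file uses p205010.
Status sentence (coordinator 2026-08-20T04:30Z): "θ(p_c) = 0 on ℤ^d, all d ≥ 2 — kernel-verified (Lean 4/Mathlib, standard axioms); internal
adversarial audit SIGNED 2026-08-20 04:29Z; external expert review pending."
Lane `prim-bschramm-*`, seat `prim-bschramm-p2` (gen 8; (R) = p2 lineage under D″); helper file (`--supports stmt-CriticalPhenomena-4575`).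

THE PLANAR FACTS a root schedule owes (per direction `du`; hypotheses here, discharged by the instance — `RootRun2.rootSched_region_subset /
_region_disjoint_Q` for `rootSched`, their `RO` twins for the schedule over `BandOKR`):
`hreg : ∀ k ≤ Sc.N, Sc.region k ⊆ P.BtwN 0 du ∪ P.Q (0 + stepVec du)` and `hQ0 : ∀ k ≤ Sc.N, Disjoint (Sc.region k) (P.Q 0)`.
* §1 `ChainPlanar.Schedule.core_subset_of_region_subset` (every core `k ≤ N + 1` lies where the regions lie);
* §2 `Skelφ.sched_stepD_subset_rootUS (hstep)`, `sched_stepD_disjoint_Q`, **`isSubbox_sched (hstep)`**;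
* §3 **`Skelφ.real_rim_le_schedSG (hlip hstep)`** — under the cut root law, `P(⋃_{z ∈ Rim_k} w₀ ↔ z) ≤ η` for every step `k ≤ Sc.N` of
  `rootWCD G φ w₀ Rt L' Sc Rlev Nc j₀ j₁ (rootUS …)`, given an excess radius `R₁ ≤ Rt − L'` at the running parameter for entrances at depth `E₀ + 1`
  (`rQ 0 0 ≤ E₀`) and habitats of planar diameter `60 rmax ≤ m`.
[cite: KozmaNitzan2024, §4 p. 27 (G₀), p. 28 ((32) at the root), Lemma 10 (p. 17), Lemma 11 (p. 22), Lemma 12 (p. 24)]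
-/

noncomputable section

open MeasureTheory ProbabilityTheory
open scoped ENNReal Classical

namespace Summit.CriticalPhenomena.PercolationContinuityZ3.Theorems

namespace Transplant

/-! ## §1 Planar: cores lie where the regions lie -/

namespace ChainPlanar.Schedule

open Literature.Probability.Percolation Literature.Probability.LatticeModels

/-- **Every core `k ≤ N + 1` of a schedule lies in any set holding all its regions** (core `0` through the `R'`-enlargement inside region `0`,
core `k + 1` through region `k`). [folklore] -/
theorem core_subset_of_region_subset (S : Schedule) {X : Finset (Site 2)} (hreg : ∀ k ≤ S.N, S.region k ⊆ X) {k : ℕ} (hk : k ≤ S.N + 1) :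
    S.core k ⊆ X := by
  rcases Nat.eq_zero_or_pos k with rfl | hpos
  · refine subset_trans ?_ (hreg 0 (Nat.zero_le _))
    refine subset_trans ?_ (S.encl 0 (Nat.zero_le _))
    rw [Schedule.core]
    refine Finset.Icc_subset_Icc (fun i => ?_) (fun i => ?_) <;>
      simp only [Pi.sub_apply, Pi.add_apply, Pi.natCast_apply] <;> omega
  · obtain ⟨k', rfl⟩ : ∃ k', k = k' + 1 := ⟨k - 1, by omega⟩
    exact (S.core_succ_subset_region (by omega)).trans (hreg k' (by omega))

end ChainPlanar.Schedule

namespace Skelφ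

open Literature.Probability.Percolation Literature.Probability.LatticeModels SimpleGraph GadgetSystem ProbeHistory HSiteScheme Contour KNCells
open Literature.Probability.Percolation.KozmaNitzan
open Literature.Probability.Percolation.KozmaNitzan.Cells (sgOf sgOf_sign)
open KNCells.KSchA KNLevels ChainPlanar
open Literature.Barriers.CriticalPhenomena (graphBall mem_graphBall_self graphBall_mono)
open BoxProdZ2 (ConcRadiiG)
open Skel (winGraph excess isSubbox_W0sub_win W0sub_eq_zero_of_not_mem_edgeSet)
open RootRun2 (abs_apply_le_of_mem_root_region₂)

variable {V : Type} [DecidableEq V] {G : SimpleGraph V} [G.LocallyFinite] {φ : V → Site 2}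
variable {P : PCells2} {w₀ : V} {Λ : ConcRadiiG} {q : unitInterval} {δc : ℝ} {Rt : ℕ} {du : MDir} {Sc : Schedule}

/-! ## §2 The regions of a root schedule in the cut root world -/

/-- **Every region of a root schedule lies in the cut root world** (radius facts with one unit of slack: the step device puts a window vertex
over `BtwN` / `Q_{0+du}` into the span). [cite: KozmaNitzan2024, §4 p. 28] -/
theorem sched_stepD_subset_rootUS (hlip : Lip G φ) (hstep : Steps G φ)
    (hreg : ∀ k ≤ Sc.N, Sc.region k ⊆ P.BtwN 0 du ∪ P.Q ((0 : Site 2) + stepVec du))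
    (hRB : Rt + 1 ≤ Λ.rB 0 0 du) (hRQ : Rt + 1 ≤ Λ.rQ 0 ((0 : Site 2) + stepVec du)) {k : ℕ} (hk : k ≤ Sc.N) :
    (planarWindowWin hlip w₀ Rt).stepD Sc k ⊆ rootUS G φ P w₀ Λ q δc Rt du := by
  intro v hv
  rw [PlanarWindow.stepD, planarWindowWin_W, mem_Win] at hv
  obtain ⟨hd, hφv⟩ := hv
  refine Finset.mem_filter.2 ⟨?_, hd⟩
  rcases Finset.mem_union.1 (hreg k hk hφv) with hB | hQ
  · refine Finset.mem_union_right _ (Finset.mem_union_left _ ?_)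
    change v ∈ VWin G φ w₀ (P.BtwN 0 du) (Λ.rB 0 0 du)
    exact mem_VWin_of_zdAdj hstep hd hRB hB (P.exists_adj_of_mem_BtwN 0 du hB)
  · refine Finset.mem_union_right _ (Finset.mem_union_right _ ?_)
    change v ∈ VWin G φ w₀ (P.Q ((0 : Site 2) + stepVec du)) (Λ.rQ 0 ((0 : Site 2) + stepVec du))
    exact mem_VWin_of_zdAdj hstep hd hRQ hQ (P.exists_adj_of_mem_Q _ hQ)

/-- **Every region of a root schedule is off the wired root cube** (planar footprints). [cite: KozmaNitzan2024, §4 p. 28] -/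
theorem sched_stepD_disjoint_Q (hlip : Lip G φ) (hQ0 : ∀ k ≤ Sc.N, Disjoint (Sc.region k) (P.Q 0)) {k : ℕ} (hk : k ≤ Sc.N) :
    Disjoint ((planarWindowWin hlip w₀ Rt).stepD Sc k)
      ((⟨cellGeomSG G φ P w₀ Λ, q, δc⟩ : KSchA V ℕ).Γ.Q (⟨cellGeomSG G φ P w₀ Λ, q, δc⟩ : KSchA V ℕ).Γ.a₀ 0) := by
  change Disjoint (Win G φ w₀ (Sc.region k) Rt) (VWin G φ w₀ (P.Q 0) (Λ.rQ 0 0))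
  exact Finset.disjoint_left.2 fun a ha hb =>
    Finset.disjoint_left.1 (hQ0 k hk) ((mem_Win G φ).1 ha).2 (φ_mem_of_mem_VWin hb)

/-- **The root law cut to the ball is a subbox weighting of the window graph on every region of a root schedule.**
[cite: KozmaNitzan2024, §4 p. 17 (subbox), p. 28] -/
theorem isSubbox_sched (hlip : Lip G φ) (hstep : Steps G φ)
    (hreg : ∀ k ≤ Sc.N, Sc.region k ⊆ P.BtwN 0 du ∪ P.Q ((0 : Site 2) + stepVec du)) (hQ0 : ∀ k ≤ Sc.N, Disjoint (Sc.region k) (P.Q 0))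
    (hRB : Rt + 1 ≤ Λ.rB 0 0 du) (hRQ : Rt + 1 ≤ Λ.rQ 0 ((0 : Site 2) + stepVec du)) {k : ℕ} (hk : k ≤ Sc.N) :
    IsSubbox (winGraph G w₀ Rt) ((⟨cellGeomSG G φ P w₀ Λ, q, δc⟩ : KSchA V ℕ).W0sub G (rootUS G φ P w₀ Λ q δc Rt du)) q
      ((planarWindowWin hlip w₀ Rt).stepD Sc k) :=
  isSubbox_W0sub_win G w₀ Rt (S := (⟨cellGeomSG G φ P w₀ Λ, q, δc⟩ : KSchA V ℕ)) (U := (⟨cellGeomSG G φ P w₀ Λ, q, δc⟩ : KSchA V ℕ).U0root du)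
    (sched_stepD_subset_rootUS hlip hstep hreg hRB hRQ hk) (sched_stepD_disjoint_Q hlip hQ0 hk)

/-! ## §3 The rim excess of a root schedule -/

/-- **THE RIM EXCESS OF A ROOT SCHEDULE**: under the cut root law, `P(⋃_{z ∈ Rim_k} w₀ ↔ z) ≤ η` for every step `k ≤ Sc.N` of the chain data
`rootWCD … Sc … (rootUS …)`, given an excess radius `R₁ ≤ Rt − L'` at the running parameter for entrances at depth `E₀ + 1` (the wired root cube
has depth `rQ 0 0 ≤ E₀`) and habitats of planar diameter `m ≥ 60 rmax`. [cite: KozmaNitzan2024, §4 Lemma 12 (p. 24), p. 28] -/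
theorem real_rim_le_schedSG [Countable V] (hlip : Lip G φ) (hstep : Steps G φ) (hΛ : WFS2 P Λ) (hφ : φ w₀ = 0)
    (hreg : ∀ k ≤ Sc.N, Sc.region k ⊆ P.BtwN 0 du ∪ P.Q ((0 : Site 2) + stepVec du)) (hQ0 : ∀ k ≤ Sc.N, Disjoint (Sc.region k) (P.Q 0))
    (hRB : Rt + 1 ≤ Λ.rB 0 0 du) (hRQ : Rt + 1 ≤ Λ.rQ 0 ((0 : Site 2) + stepVec du))
    {E₀ : ℕ} (hE0 : Λ.rQ 0 0 ≤ E₀) {m : ℕ} (hm : 60 * P.rmax ≤ m) {η : ℝ} {R₁ : ℕ}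
    (hR₁ : ∀ R'', R₁ ≤ R'' → ∀ (Rw : ℕ) (D' A' : Finset V), (∀ d ∈ D', d ∈ graphBall G w₀ Rw) →
      (∀ d ∈ D', ∀ d' ∈ D', φ d - φ d' ∈ box 2 m) → A' ⊆ D' → (∀ a ∈ A', a ∈ graphBall G w₀ (E₀ + 1)) →
        (bondPercolation G q).real (excess G w₀ R'' D' A') ≤ η)
    {L' : ℕ} (hR : R₁ ≤ Rt - L') {Rlev Nc j₀ j₁ : ℕ} {k : ℕ} (hk : k ≤ Sc.N) :
    (prodBernoulli ((⟨cellGeomSG G φ P w₀ Λ, q, δc⟩ : KSchA V ℕ).W0sub G (rootUS G φ P w₀ Λ q δc Rt du))).real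
      (⋃ z ∈ (rootWCD G φ w₀ Rt L' Sc Rlev Nc j₀ j₁ (rootUS G φ P w₀ Λ q δc Rt du)).Rim k, openConn w₀ z) ≤ η := by
  set S : KSchA V ℕ := ⟨cellGeomSG G φ P w₀ Λ, q, δc⟩ with hSdef
  set U' := rootUS G φ P w₀ Λ q δc Rt du with hU'
  set Pc := rootWCD G φ w₀ Rt L' Sc Rlev Nc j₀ j₁ U' with hPc
  set D : Finset V := U' \ S.Γ.Q S.Γ.a₀ 0 with hD
  have hWD : IsSubbox (winGraph G w₀ Rt) (S.W0sub G U') q D :=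
    isSubbox_W0sub_win G w₀ Rt (S := S) (U := S.U0root du) Finset.sdiff_subset Finset.sdiff_disjoint
  have hDπ : ∀ v ∈ D, v ∈ graphBall G w₀ Rt := fun v hv => (Finset.mem_filter.1 (Finset.mem_sdiff.1 hv).1).2
  have hWG : ∀ e, e ∉ G.edgeSet → S.W0sub G U' e = 0 := fun e he => W0sub_eq_zero_of_not_mem_edgeSet S U' he
  have hrootQ : w₀ ∈ S.Γ.Q S.Γ.a₀ 0 := (sepGeomSG P w₀ hΛ hφ hstep).root_mem
  have hroot : w₀ ∉ D := fun h' => (Finset.mem_sdiff.1 h').2 hrootQ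
  have hRimD : Pc.Rim k ⊆ D := by
    intro z hz
    have hz' : z ∈ (planarWindowWin hlip w₀ Rt).stepD Sc k := rootWCD_Rim_subset hlip w₀ Rt L' Sc Rlev Nc j₀ j₁ U' k hz
    exact Finset.mem_sdiff.2 ⟨sched_stepD_subset_rootUS hlip hstep hreg hRB hRQ hk hz',
      Finset.disjoint_left.1 (sched_stepD_disjoint_Q hlip (w₀ := w₀) (Λ := Λ) (q := q) (δc := δc) (Rt := Rt) hQ0 hk) hz'⟩
  have hRimfar : ∀ z ∈ Pc.Rim k, z ∉ graphBall G w₀ (Rt - L') := fun z hz => not_mem_graphBall_of_mem_rootWCD_Rim hz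
  have hA : ∀ a b, a ∉ D → b ∈ D → G.Adj a b → S.W0sub G U' s(a, b) ≠ 0 → b ∈ graphBall G w₀ (E₀ + 1) := by
    intro a b ha hb hadj hw
    have haU : a ∈ U' := by
      by_contra haU
      apply hw
      unfold KSchA.W0sub
      exact restrW_apply_of_not_mem _ (fun h' => haU (Finset.mem_coe.1 (h'.1 a (Sym2.mem_mk_left _ _))))
    have haQ : a ∈ S.Γ.Q S.Γ.a₀ 0 := by
      by_contra haQ
      exact ha (Finset.mem_sdiff.2 ⟨haU, haQ⟩)
    have ha1 : a ∈ graphBall G w₀ E₀ := by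
      change a ∈ VWin G φ w₀ (P.Q 0) (Λ.rQ 0 0) at haQ
      exact graphBall_mono G w₀ hE0 (mem_graphBall_of_mem_VWin haQ)
    exact BoxProdZ2.mem_graphBall_succ_of_adj G ha1 hadj
  refine real_rim_le_of_radius (Wt := S.W0sub G U') (q := q) (D := D) (root := w₀) (w₀ := w₀) (R := Rt) (L' := L') (R₀' := E₀ + 1)
    (Rim := Pc.Rim k) (m := m) (η := η) (R₁ := R₁) (by convert hWD) hDπ hWG hroot hRimD hRimfar hA ?_ hR (Rw := Rt) hDπ
    (fun d hd d' hd' => φ_sub_φ_mem_box_of_mem_rootUS hm hd hd')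
  intro R'' hR'' Rw D' A' h1 h2 h3 h4
  convert hR₁ R'' hR'' Rw D' A' h1 h2 h3 h4 using 3

end Skelφ

end Transplant

end Summit.CriticalPhenomena.PercolationContinuityZ3.Theorems

end
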